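import Literature.NumberTheory.DiophantineGeometry.TateAlgorithmThreeTableWalkProofs
import Literature.NumberTheory.DiophantineGeometry.TateAlgorithmTranslationsProofs
import Literature.NumberTheory.DiophantineGeometry.TateAlgorithmLocal
import HarnessLib

/-!
# Route `TameQuarticSolvent`, crux `SolventPairLowerBound` (stmt-BirchSwinnertonDyer-21391), line `birth`,
# stub `stub_goodReduction` — LOCAL HALF over a DVR: the tame class (t′) at `3` is Kodaira `III` / `III*`
# and admits the "medium" normal form `y² = x³ + A₂x² + A₄x + A₆` with `(3 ∣ A₂, 3 ∣ A₄, 9 ∣ A₆, ord Δ = 3)`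
# resp. `(9 ∣ A₂, 27 ∣ A₄, 3⁵ ∣ A₆, ord Δ = 9)`

HONEST FRAMING. Theorems only (no definition, no named fact, no route file imported); helper toward the
registered stub `stub_goodReduction` of the birth skeleton of the deciding crux of route
`TameQuarticSolvent` (`--supports stmt-BirchSwinnertonDyer-21391`). BSD is not proved by any of this.

WHAT. `R` is a discrete valuation ring with perfect residue field; in §2 `2 ∈ Rˣ`; in §3 moreover `3` is a
uniformiser (e.g. `R = ℤ₃`). `V` is an `R`-integral Weierstrass equation.

* §1 `exists_step2Model_of_kodairaSymbolOfMinimal_eq_III`, `exists_step9Model_of_kodairaSymbolOfMinimal_eq_IIIstar`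
  — if the tree's literal Tate algorithm `kodairaSymbolOfMinimal` returns `III` (resp. `III*`), the Step-2
  model `W₂ = (1,r,s,t) • V` has `π ∣ b₂, a₃, a₄`, `π² ∣ a₆` (resp. the Step-9 model has `π ∣ a₁`,
  `π² ∣ a₂`, `π³ ∣ a₃, a₄`, `π⁵ ∣ a₆`). This is the `if`-cascade of Silverman *ATAEC* IV.9.4 unfolded exactly
  as in the tree's `TateAlgorithm.addVal_Δ_toNat_eq_three_of_kodairaSymbolOfMinimal_eq_III` /
  `…_nine_…_IIIstar` (`TateAlgorithmTameTypesOddProofs`), exporting the normalised MODELS rather than `ord Δ`.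
* §2 `exists_variableChange_mediumForm` — completing the square (`2 ∈ Rˣ`): `(1, 0, −a₁/2, −a₃/2) • V` has
  `a₁ = a₃ = 0` and `4a₂' = b₂`, `2a₄' = b₄`, `4a₆' = b₆` (Silverman *AEC* III.1); whence the medium forms
  `exists_mediumForm_of_kodairaSymbolOfMinimal_eq_III{,star}`.
* §3 `kodairaSymbolOfMinimal_eq_III_or_IIIstar_of_tprime` — for a MINIMAL equation (`Δ ≠ 0`, Step 11
  excluded) with additive reduction (`3 ∣ Δ`, `3 ∣ c₄`), Ogg value `ord Δ + 1 − m = 2` (`f = 2`), `6 ∤ ord Δ`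
  (semistability index `12/gcd(12, ord Δ) ∤ 2`) and `ord j ≥ 0` in the form `c₄ = 0 ∨ ord Δ ≤ 3 ord c₄`,
  the symbol is `III` with `ord Δ = 3` or `III*` with `ord Δ = 9`: read off the 24-row table of Papadopoulos
  (J. Number Theory 44 (1993), Table III, `p = 3`) = tree `TateAlgorithm.rowDatum_of_minimal` (all other
  rows have `f ∈ {0,1,3,4,5}`, or `ord Δ = 6` (`I₀*`), or `ord j < 0` (`Iₙ*`, `n ≥ 1`)).
  `exists_mediumForm_of_tprime` combines §1–§3.

References: J. H. Silverman, *ATAEC* (GTM 151) IV.9.4 and Table 4.1; I. Papadopoulos, J. Number Theory 44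
(1993) Table III; J. H. Silverman, *AEC* III.1 (completing the square), VII.1.
-/

-- D-0017: single-problem summit, so `Summit.BirchSwinnertonDyer.BirchSwinnertonDyer.…` repeats a namespace BY DESIGN.
set_option linter.dupNamespace false

open IsLocalRing
open IsDiscreteValuationRing hiding maximalIdeal
open Literature Literature.NumberTheory.DiophantineGeometry
  Literature.NumberTheory.DiophantineGeometry.TateAlgorithm

namespace Summit.BirchSwinnertonDyer.BirchSwinnertonDyer.Theorems.SolventPairLowerBound

/-! ## §1 The normalised models behind the outputs `III` and `III*` -/

section StepModels

variable {R : Type*} [CommRing R] [IsDomain R] [IsDiscreteValuationRing R]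

/-- **Output `III` ⇒ the Step-2 model.** If Tate's algorithm returns `III` on `V`, then Steps 1–3 failed and
Step 4 fired, the Step-2 translation exists (perfect residue field), and the Step-2 model
`W₂ = (1,r,s,t) • V` satisfies `π ∣ b₂` (Step 2 failed), `π ∣ a₃, a₄` and `π² ∣ a₆` (Step 3 failed).
Silverman *ATAEC* IV.9.4, Steps 2–4. [cite: SilvermanATAEC1994, IV.9.4 Steps 2–4] -/
theorem exists_step2Model_of_kodairaSymbolOfMinimal_eq_III [PerfectField (ResidueField R)]
    (V : WeierstrassCurve R) (hV : V.kodairaSymbolOfMinimal = .III) :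
    ∃ C : WeierstrassCurve.VariableChange R, C.u = 1 ∧
      (C • V).b₂ ∈ maximalIdeal R ∧ (C • V).a₃ ∈ maximalIdeal R ∧ (C • V).a₄ ∈ maximalIdeal R ∧
      (C • V).a₆ ∈ maximalIdeal R ^ 2 := by
  classical
  -- the `if`-cascade of `kodairaSymbolOfMinimal` returns `III` iff Steps 1–3 fail, Step 4 fires
  have tree : ∀ (p1 p2 p3 p4 p5 p6 p7 p8 p9 p10 : Prop) [Decidable p1] [Decidable p2]
      [Decidable p3] [Decidable p4] [Decidable p5] [Decidable p6] [Decidable p7] [Decidable p8]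
      [Decidable p9] [Decidable p10] (n m : ℕ),
      (if p1 then KodairaSymbol.I 0 else if p2 then .I n else if p3 then .II else if p4 then .III
        else if p5 then .IV else if p6 then .Istar 0 else if p7 then .Istar m
        else if p8 then .IVstar else if p9 then .IIIstar else if p10 then .IIstar else .I 0) =
          .III ↔ ¬ p1 ∧ ¬ p2 ∧ ¬ p3 ∧ p4 := by
    intros; split_ifs <;> simp [*]
  unfold WeierstrassCurve.kodairaSymbolOfMinimal at hV
  obtain ⟨h1, h2', h3, -⟩ := (tree _ _ _ _ _ _ _ _ _ _ _ _).mp hV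
  rw [not_not] at h1 h2' h3
  have hex2 := exists_variableChange_step2_of_perfectField V h1
  have hN2 : normalizeStep2 V = hex2.choose • V := dif_pos hex2
  obtain ⟨hu2, hA₃, hA₄, -⟩ := hex2.choose_spec
  rw [hN2] at h2' h3
  exact ⟨hex2.choose, hu2, h2', hA₃, hA₄, h3⟩

/-- **Output `III*` ⇒ the Step-9 model.** If Tate's algorithm returns `III*` on `V`, then Steps 1–8
failed, the Step-2, -6, -8 and -9 translations exist (perfect residue field), and the Step-9 model
`W₉ = (1,r,s,t) • V` satisfies `π ∣ a₁`, `π² ∣ a₂`, `π³ ∣ a₃`, `π³ ∣ a₄`, `π⁵ ∣ a₆`.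
Silverman *ATAEC* IV.9.4, Steps 2–9. [cite: SilvermanATAEC1994, IV.9.4 Steps 2–9] -/
theorem exists_step9Model_of_kodairaSymbolOfMinimal_eq_IIIstar [PerfectField (ResidueField R)]
    (V : WeierstrassCurve R) (hV : V.kodairaSymbolOfMinimal = .IIIstar) :
    ∃ C : WeierstrassCurve.VariableChange R, C.u = 1 ∧
      (C • V).a₁ ∈ maximalIdeal R ∧ (C • V).a₂ ∈ maximalIdeal R ^ 2 ∧
      (C • V).a₃ ∈ maximalIdeal R ^ 3 ∧ (C • V).a₄ ∈ maximalIdeal R ^ 3 ∧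
      (C • V).a₆ ∈ maximalIdeal R ^ 5 := by
  classical
  -- the `if`-cascade returns `III*` iff Steps 1–8 fail and Step 9 fires
  have tree : ∀ (p1 p2 p3 p4 p5 p6 p7 p8 p9 p10 : Prop) [Decidable p1] [Decidable p2]
      [Decidable p3] [Decidable p4] [Decidable p5] [Decidable p6] [Decidable p7] [Decidable p8]
      [Decidable p9] [Decidable p10] (n m : ℕ),
      (if p1 then KodairaSymbol.I 0 else if p2 then .I n else if p3 then .II else if p4 then .III
        else if p5 then .IV else if p6 then .Istar 0 else if p7 then .Istar m
        else if p8 then .IVstar else if p9 then .IIIstar else if p10 then .IIstar else .I 0) =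
          .IIIstar ↔ ¬ p1 ∧ ¬ p2 ∧ ¬ p3 ∧ ¬ p4 ∧ ¬ p5 ∧ ¬ p6 ∧ ¬ p7 ∧ ¬ p8 ∧ p9 := by
    intros; split_ifs <;> simp [*]
  unfold WeierstrassCurve.kodairaSymbolOfMinimal at hV
  obtain ⟨h1, h2', h3, h4, h5, h6, h7, h8, -⟩ := (tree _ _ _ _ _ _ _ _ _ _ _ _).mp hV
  rw [not_not] at h1 h2' h3 h4 h5
  -- Step 2
  have hex2 := exists_variableChange_step2_of_perfectField V h1
  have hN2 : normalizeStep2 V = hex2.choose • V := dif_pos hex2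
  obtain ⟨hu2, hA₃, hA₄, -⟩ := hex2.choose_spec
  rw [hN2] at h2' h3 h4 h5 h6 h7 h8
  -- Step 6
  have hex6 := exists_variableChange_step6_of_perfectField h2' hA₃ hA₄ h3 h5 h4
  have hN6 : normalizeStep6 (hex2.choose • V) = hex6.choose • (hex2.choose • V) :=
    dif_pos hex6
  obtain ⟨hu6, hB₁, hB₂, hB₃, hB₄, hB₆⟩ := hex6.choose_spec
  rw [hN6] at h6 h7 h8
  -- Step 8
  have hex8 := exists_variableChange_step8_of_perfectField hB₁ hB₂ hB₃ hB₄ hB₆ h6 h7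
  have hN8 : normalizeStep8 (hex6.choose • (hex2.choose • V)) =
      hex8.choose • (hex6.choose • (hex2.choose • V)) := dif_pos hex8
  obtain ⟨hu8, hD₁, hD₂, hD₃, hD₄, hD₆⟩ := hex8.choose_spec
  rw [hN8] at h8
  -- Step 9
  have hex9 := exists_variableChange_step9_of_perfectField hD₁ hD₂ hD₃ hD₄ hD₆ h8
  obtain ⟨hu9, hE₁, hE₂, hE₃, hE₄, hE₆⟩ := hex9.choose_spec
  refine ⟨hex9.choose * hex8.choose * hex6.choose * hex2.choose, ?_, ?_⟩
  · show hex9.choose.u * hex8.choose.u * hex6.choose.u * hex2.choose.u = 1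
    rw [hu9, hu8, hu6, hu2]; simp
  · simp only [mul_smul]
    exact ⟨hE₁, hE₂, hE₃, hE₄, hE₆⟩

end StepModels

/-! ## §2 Completing the square: the medium Weierstrass form `y² = x³ + A₂x² + A₄x + A₆` -/

section MediumForm

variable {R : Type*} [CommRing R]

/-- **Completing the square** when `2 ∈ Rˣ`: the `u = 1` change `(1, 0, −a₁/2, −a₃/2)` gives a model with
`a₁ = a₃ = 0`, `4a₂' = b₂`, `2a₄' = b₄`, `4a₆' = b₆` (i.e. `y² = x³ + (b₂/4)x² + (b₄/2)x + b₆/4`).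
Silverman *AEC* III.1 (the substitution `y ↦ (y − a₁x − a₃)/2`). [cite: SilvermanAEC2009, III.1] -/
theorem exists_variableChange_mediumForm (h2 : IsUnit (2 : R)) (W : WeierstrassCurve R) :
    ∃ C : WeierstrassCurve.VariableChange R, C.u = 1 ∧ (C • W).a₁ = 0 ∧ (C • W).a₃ = 0 ∧
      4 * (C • W).a₂ = W.b₂ ∧ 2 * (C • W).a₄ = W.b₄ ∧ 4 * (C • W).a₆ = W.b₆ := by
  obtain ⟨i2, hi2⟩ := h2.exists_right_inv
  refine ⟨⟨1, 0, -W.a₁ * i2, -W.a₃ * i2⟩, rfl, ?_, ?_, ?_, ?_, ?_⟩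
  · rw [smul_a₁_of_u_eq_one rfl]
    dsimp only
    linear_combination (-W.a₁) * hi2
  · rw [smul_a₃_of_u_eq_one rfl]
    dsimp only
    linear_combination (-W.a₃) * hi2
  · rw [smul_a₂_of_u_eq_one rfl]
    dsimp only
    simp only [WeierstrassCurve.b₂]
    linear_combination (-W.a₁ ^ 2 * (2 * i2 - 1)) * hi2
  · rw [smul_a₄_of_u_eq_one rfl]
    dsimp only
    simp only [WeierstrassCurve.b₄]
    linear_combination (-W.a₁ * W.a₃ * (2 * i2 - 1)) * hi2
  · rw [smul_a₆_of_u_eq_one rfl]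
    dsimp only
    simp only [WeierstrassCurve.b₆]
    linear_combination (-W.a₃ ^ 2 * (2 * i2 - 1)) * hi2

variable [IsDomain R] [IsDiscreteValuationRing R]

/-- **Medium form of type `III`.** If `2 ∈ Rˣ` and Tate's algorithm returns `III` on `V` (perfect residue
field), some `u = 1` change of variables brings `V` to `y² = x³ + A₂x² + A₄x + A₆` with `π ∣ A₂`,
`π ∣ A₄`, `π² ∣ A₆`: complete the square on the Step-2 model (`4A₂ = b₂`, `2A₄ = b₄ = 2a₄ + a₁a₃`,
`4A₆ = b₆ = a₃² + 4a₆`). Silverman *ATAEC* IV.9.4 Steps 2–4 with *AEC* III.1.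
[cite: SilvermanATAEC1994, IV.9.4 Steps 2–4] -/
theorem exists_mediumForm_of_kodairaSymbolOfMinimal_eq_III [PerfectField (ResidueField R)]
    (h2 : IsUnit (2 : R)) (V : WeierstrassCurve R) (hV : V.kodairaSymbolOfMinimal = .III) :
    ∃ C : WeierstrassCurve.VariableChange R, C.u = 1 ∧ (C • V).a₁ = 0 ∧ (C • V).a₃ = 0 ∧
      (C • V).a₂ ∈ maximalIdeal R ∧ (C • V).a₄ ∈ maximalIdeal R ∧
      (C • V).a₆ ∈ maximalIdeal R ^ 2 := by
  obtain ⟨C₂, hu₂, hb₂, ha₃, ha₄, ha₆⟩ := exists_step2Model_of_kodairaSymbolOfMinimal_eq_III V hV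
  obtain ⟨S, huS, h₁, h₃, h₂', h₄', h₆'⟩ := exists_variableChange_mediumForm h2 (C₂ • V)
  have h4 : IsUnit (4 : R) := isUnit_four h2
  refine ⟨S * C₂, by show S.u * C₂.u = 1; rw [huS, hu₂, mul_one], ?_, ?_, ?_, ?_, ?_⟩
    <;> rw [mul_smul]
  · exact h₁
  · exact h₃
  · rw [← Ideal.unit_mul_mem_iff_mem _ h4, h₂']
    exact hb₂
  · rw [← Ideal.unit_mul_mem_iff_mem _ h2, h₄', WeierstrassCurve.b₄]
    exact Ideal.add_mem _ (Ideal.mul_mem_left _ _ ha₄) (Ideal.mul_mem_left _ _ ha₃)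
  · rw [← Ideal.unit_mul_mem_iff_mem _ h4, h₆', WeierstrassCurve.b₆]
    exact Ideal.add_mem _ (by simpa only [sq] using Ideal.mul_mem_mul ha₃ ha₃)
      (Ideal.mul_mem_left _ _ ha₆)

/-- **Medium form of type `III*`.** If `2 ∈ Rˣ` and Tate's algorithm returns `III*` on `V` (perfect residue
field), some `u = 1` change of variables brings `V` to `y² = x³ + A₂x² + A₄x + A₆` with `π² ∣ A₂`,
`π³ ∣ A₄`, `π⁵ ∣ A₆`: complete the square on the Step-9 model (`π ∣ a₁`, `π² ∣ a₂`, `π³ ∣ a₃, a₄`,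
`π⁵ ∣ a₆`, so `π² ∣ b₂`, `π³ ∣ b₄`, `π⁵ ∣ b₆`). Silverman *ATAEC* IV.9.4 Steps 2–9 with *AEC* III.1.
[cite: SilvermanATAEC1994, IV.9.4 Steps 2–9] -/
theorem exists_mediumForm_of_kodairaSymbolOfMinimal_eq_IIIstar [PerfectField (ResidueField R)]
    (h2 : IsUnit (2 : R)) (V : WeierstrassCurve R) (hV : V.kodairaSymbolOfMinimal = .IIIstar) :
    ∃ C : WeierstrassCurve.VariableChange R, C.u = 1 ∧ (C • V).a₁ = 0 ∧ (C • V).a₃ = 0 ∧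
      (C • V).a₂ ∈ maximalIdeal R ^ 2 ∧ (C • V).a₄ ∈ maximalIdeal R ^ 3 ∧
      (C • V).a₆ ∈ maximalIdeal R ^ 5 := by
  obtain ⟨C₉, hu₉, ha₁, ha₂, ha₃, ha₄, ha₆⟩ :=
    exists_step9Model_of_kodairaSymbolOfMinimal_eq_IIIstar V hV
  obtain ⟨S, huS, h₁, h₃, h₂', h₄', h₆'⟩ := exists_variableChange_mediumForm h2 (C₉ • V)
  have h4 : IsUnit (4 : R) := isUnit_four h2
  refine ⟨S * C₉, by show S.u * C₉.u = 1; rw [huS, hu₉, mul_one], ?_, ?_, ?_, ?_, ?_⟩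
    <;> rw [mul_smul]
  · exact h₁
  · exact h₃
  · rw [← Ideal.unit_mul_mem_iff_mem _ h4, h₂', WeierstrassCurve.b₂]
    exact Ideal.add_mem _ (by simpa only [sq] using Ideal.mul_mem_mul ha₁ ha₁)
      (Ideal.mul_mem_left _ _ ha₂)
  · rw [← Ideal.unit_mul_mem_iff_mem _ h2, h₄', WeierstrassCurve.b₄]
    exact Ideal.add_mem _ (Ideal.mul_mem_left _ _ ha₄) (Ideal.mul_mem_left _ _ ha₃)
  · rw [← Ideal.unit_mul_mem_iff_mem _ h4, h₆', WeierstrassCurve.b₆]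
    refine Ideal.add_mem _ ?_ (Ideal.mul_mem_left _ _ ha₆)
    have h6 : (C₉ • V).a₃ ^ 2 ∈ maximalIdeal R ^ 6 := by
      simpa only [sq, ← pow_add] using Ideal.mul_mem_mul ha₃ ha₃
    exact Ideal.pow_le_pow_right (by norm_num) h6

end MediumForm

/-! ## §3 The tame class (t′) at `3`: Kodaira `III` or `III*` -/

section Tprime

variable {R : Type*} [CommRing R] [IsDomain R] [IsDiscreteValuationRing R]

/-- **(t′) at `3` is Kodaira `III` (`ord Δ = 3`) or `III*` (`ord Δ = 9`).** Let `R` be a DVR with perfect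
residue field, `2 ∈ Rˣ`, `3` a uniformiser, and `W` a minimal Weierstrass equation over `R` (`Δ ≠ 0`; no
`(1,r,s,t)` achieves `π ∣ a₁, …, π⁶ ∣ a₆`) with additive reduction (`3 ∣ Δ`, `3 ∣ c₄`), TAME conductor
`f = ord Δ + 1 − m = 2`, semistability index not dividing `2` (`6 ∤ ord Δ`) and potentially good
reduction (`ord j ≥ 0`, as `c₄ = 0 ∨ ord Δ ≤ 3·ord c₄`). Then Tate's algorithm returns `III` with
`ord Δ = 3` or `III*` with `ord Δ = 9`. Proof: the 24 rows of Papadopoulos's table at `p = 3` (tree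
`TateAlgorithm.rowDatum_of_minimal`): `I₀`, `Iₙ` are not additive; `II`, `IV`, `IV*`, `II*` have
`f = ord Δ + 1 − m ∈ {3,4,5}`; `I₀*` has `ord Δ = 6`; `Iₙ*` (`n ≥ 1`) has `ord Δ = n + 6 > 6 = 3·ord c₄`.
[cite: Papadopoulos1993, Table III (p = 3)] [cite: SilvermanATAEC1994, IV.9.4 and Table 4.1] -/
theorem kodairaSymbolOfMinimal_eq_III_or_IIIstar_of_tprime [PerfectField (ResidueField R)]
    (h2 : IsUnit (2 : R)) (h3 : Irreducible (3 : R)) (W : WeierstrassCurve R) (hΔ0 : W.Δ ≠ 0)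
    (hmin : ∀ C : WeierstrassCurve.VariableChange R, C.u = 1 →
      uniformizer R ∣ (C • W).a₁ → uniformizer R ^ 2 ∣ (C • W).a₂ →
      uniformizer R ^ 3 ∣ (C • W).a₃ → uniformizer R ^ 4 ∣ (C • W).a₄ →
      uniformizer R ^ 6 ∣ (C • W).a₆ → False)
    (hΔ : (3 : R) ∣ W.Δ) (hc₄ : (3 : R) ∣ W.c₄)
    (hf : (addVal R W.Δ).toNat + 1 - W.kodairaSymbolOfMinimal.numComponents = 2)
    (h6 : ¬ 6 ∣ (addVal R W.Δ).toNat)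
    (hj : W.c₄ = 0 ∨ (addVal R W.Δ).toNat ≤ 3 * (addVal R W.c₄).toNat) :
    (W.kodairaSymbolOfMinimal = .III ∧ (addVal R W.Δ).toNat = 3) ∨
      (W.kodairaSymbolOfMinimal = .IIIstar ∧ (addVal R W.Δ).toNat = 9) := by
  have hrow := rowDatum_of_minimal h2 h3 W hΔ0 hmin
  rcases hrow with ⟨-, hΔ3, -⟩ | ⟨n, -, -, -, hc4nd, -⟩ | ⟨hK, hsub⟩ | ⟨hK, hΔv, -⟩ | ⟨hK, hsub⟩ |
      ⟨-, hΔv, -⟩ | ⟨n, hn1, -, hnΔ, h4v, -⟩ | ⟨hK, hsub⟩ | ⟨hK, hΔv, -⟩ | ⟨hK, hsub⟩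
  · exact absurd hΔ hΔ3
  · exact absurd hc₄ hc4nd
  · rw [hK] at hf
    simp only [KodairaSymbol.numComponents] at hf
    rcases hsub with ⟨hΔv, -⟩ | ⟨hΔv, -⟩ | ⟨hΔv, -⟩ | ⟨hΔv, -⟩ <;> omega
  · exact Or.inl ⟨hK, hΔv⟩
  · rw [hK] at hf
    simp only [KodairaSymbol.numComponents] at hf
    rcases hsub with ⟨-, -, hΔv⟩ | ⟨-, -, hΔv⟩ | ⟨-, -, hΔv⟩ <;> omega
  · rw [hΔv] at h6
    exact absurd (dvd_refl 6) h6
  · rcases hj with hc0 | hle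
    · rw [hc0, addVal_zero] at h4v
      simp at h4v
    · omega
  · rw [hK] at hf
    simp only [KodairaSymbol.numComponents] at hf
    rcases hsub with ⟨-, -, hΔv, -⟩ | ⟨-, -, hΔv⟩ | ⟨-, -, hΔv⟩ | ⟨-, -, hΔv⟩ <;> omega
  · exact Or.inr ⟨hK, hΔv⟩
  · rw [hK] at hf
    simp only [KodairaSymbol.numComponents] at hf
    rcases hsub with ⟨-, -, hΔv⟩ | ⟨-, -, hΔv⟩ | ⟨-, -, hΔv⟩ <;> omega

/-- **Medium normal form on (t′) at `3`.** Under the hypotheses of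
`kodairaSymbolOfMinimal_eq_III_or_IIIstar_of_tprime`, some `u = 1` change of variables brings `W` to
`y² = x³ + A₂x² + A₄x + A₆` with EITHER `3 ∣ A₂`, `3 ∣ A₄`, `9 ∣ A₆` and `ord Δ = 3` (type `III`) OR
`9 ∣ A₂`, `27 ∣ A₄`, `3⁵ ∣ A₆` and `ord Δ = 9` (type `III*`). These divisibilities are what makes the
rescaling `(x, y) ↦ (ϖ²x, ϖ³y)` resp. `(ϖ⁶x, ϖ⁹y)` integral over any extension with `ϖ⁴ ∼ 3` (the quartic
descent of the companion file). [cite: SilvermanATAEC1994, IV.9.4 and Table 4.1]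
[cite: Papadopoulos1993, Table III (p = 3)] -/
theorem exists_mediumForm_of_tprime [PerfectField (ResidueField R)]
    (h2 : IsUnit (2 : R)) (h3 : Irreducible (3 : R)) (W : WeierstrassCurve R) (hΔ0 : W.Δ ≠ 0)
    (hmin : ∀ C : WeierstrassCurve.VariableChange R, C.u = 1 →
      uniformizer R ∣ (C • W).a₁ → uniformizer R ^ 2 ∣ (C • W).a₂ →
      uniformizer R ^ 3 ∣ (C • W).a₃ → uniformizer R ^ 4 ∣ (C • W).a₄ →
      uniformizer R ^ 6 ∣ (C • W).a₆ → False)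
    (hΔ : (3 : R) ∣ W.Δ) (hc₄ : (3 : R) ∣ W.c₄)
    (hf : (addVal R W.Δ).toNat + 1 - W.kodairaSymbolOfMinimal.numComponents = 2)
    (h6 : ¬ 6 ∣ (addVal R W.Δ).toNat)
    (hj : W.c₄ = 0 ∨ (addVal R W.Δ).toNat ≤ 3 * (addVal R W.c₄).toNat) :
    ∃ C : WeierstrassCurve.VariableChange R, C.u = 1 ∧ (C • W).a₁ = 0 ∧ (C • W).a₃ = 0 ∧
      (((C • W).a₂ ∈ maximalIdeal R ∧ (C • W).a₄ ∈ maximalIdeal R ∧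
          (C • W).a₆ ∈ maximalIdeal R ^ 2 ∧ (addVal R W.Δ).toNat = 3) ∨
        ((C • W).a₂ ∈ maximalIdeal R ^ 2 ∧ (C • W).a₄ ∈ maximalIdeal R ^ 3 ∧
          (C • W).a₆ ∈ maximalIdeal R ^ 5 ∧ (addVal R W.Δ).toNat = 9)) := by
  rcases kodairaSymbolOfMinimal_eq_III_or_IIIstar_of_tprime h2 h3 W hΔ0 hmin hΔ hc₄ hf h6 hj with
    ⟨hK, hv⟩ | ⟨hK, hv⟩
  · obtain ⟨C, hu, h₁, h₃, h₂', h₄, h₆⟩ := exists_mediumForm_of_kodairaSymbolOfMinimal_eq_III h2 W hK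
    exact ⟨C, hu, h₁, h₃, Or.inl ⟨h₂', h₄, h₆, hv⟩⟩
  · obtain ⟨C, hu, h₁, h₃, h₂', h₄, h₆⟩ :=
      exists_mediumForm_of_kodairaSymbolOfMinimal_eq_IIIstar h2 W hK
    exact ⟨C, hu, h₁, h₃, Or.inr ⟨h₂', h₄, h₆, hv⟩⟩

end Tprime

end Summit.BirchSwinnertonDyer.BirchSwinnertonDyer.Theorems.SolventPairLowerBound
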